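import Mathlib.Data.ZMod.Basic
import Mathlib.Data.Finset.Powerset
import Mathlib.Data.Finset.Card
import Mathlib.Data.Fintype.Sum
import Mathlib.Data.Fintype.Powerset
import Mathlib.Tactic.DeriveFintype
import HarnessLib

/-!
# Pohlmann sets of the CM sixfold `B × E′ × E″` with `B` of type `(ℚ(ζ₂₄), {σ₁, σ₅, σ₇, σ₁₃})` — a kernel census

A finite, kernel-decided computation (no named fact, no geometry) supporting the B2b hodge-weil carver's
evidence note on ledger item stmt-…-18721 (the census item `CodimTwoFromLowerDim`, "X2"): for the CM algebra
`E = ℚ(ζ₂₄) × k′ × k″` with `k′ ≠ k″` imaginary quadratic subfields of `ℚ(ζ₂₄)` and the CM type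
`Φ = {σ₁, σ₅, σ₇, σ₁₃} ⊔ {ι′} ⊔ {ι″}`, the number of `4`-subsets `P ⊂ Hom(E, ℂ)` satisfying Pohlmann's
condition (3.2) `|gP ∩ Φ| = |gP ∩ Φ̄|` for all `g ∈ Gal(ℚ(ζ₂₄)/ℚ) = (ℤ/24)ˣ` is `19 = 15 + 4`, and the four
sets that are not unions of two complex-conjugate pairs meet all three blocks (two embeddings of `ℚ(ζ₂₄)`, one of
`k′`, one of `k″`). DICTIONARY (not formalised here; it is the tree's
`Literature.AlgebraicGeometry.GaoUllmo2025.theorem31` / `theorem31_finrank` = [cite: GaoUllmo2025, Thm 3.1], Pohlmann's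
theorem for an ARBITRARY CM abelian variety): these counts are `dim_ℚ B²(A) = 19` and "`B²(A) ⊋ D²(A)` by a
4-dimensional space of classes of Künneth multidegree `(2,1,1)`" for the abelian sixfold `A = B × E′ × E″`, `B` the
simple CM fourfold of type `(ℚ(ζ₂₄), {σ₁,σ₅,σ₇,σ₁₃})` (the type is primitive: `primitive_phiB`), `E′`, `E″`
elliptic curves with CM by `k′`, `k″` — Moonen–Zarhin's case (g) [cite: MoonenZarhin1999, Introduction (g)] for both
`E′ × B` and `E″ × B`.

MODEL. Points `S = ZMod 24 ⊕ (Bool ⊕ Bool)`: `inl t` (with `t` a unit) is the embedding `σ_t : ζ₂₄ ↦ ζ₂₄^t`;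
`inr (inl b)` / `inr (inr b)` are the two embeddings of `k′` / `k″` (`true` = the one in the CM type). A unit `g`
acts by `σ_t ↦ σ_{gt}` and on `k` by the identity iff `g` fixes `k` (`fixes k g`), else by the swap; complex
conjugation is `g = -1 = 23`. The four imaginary quadratic subfields of `ℚ(ζ₂₄) = ℚ(i, √2, √3)`:
`ℚ(i)` (fixed iff `g ≡ 1 mod 4`), `ℚ(√-2)` (iff `g ≡ 1, 3 mod 8`), `ℚ(√-3)` (iff `g ≡ 1 mod 3`),
`ℚ(√-6)` (iff `g` fixes both or neither of `√-2`, `√3`, the latter iff `g ≡ ±1 mod 12`). [folklore]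

## References
* [GaoUllmo2025] Z. Gao, E. Ullmo, J. Inst. Math. Jussieu 25 (2025) 215–249 = arXiv:2411.12249, Thm 3.1.
* [Pohlmann1968] H. Pohlmann, Ann. of Math. (2) 88 (1968) 161–180, Thm 1.
* [MoonenZarhin1999] B. Moonen, Yu. Zarhin, Hodge classes on abelian varieties of low dimension,
  Math. Ann. 315 (1999) 711–733 = arXiv:math/9901113, Introduction, cases (a)–(g).

## Provenance
Kernel cost: two `decide +kernel` evaluations over the `495` four-subsets of the twelve points.
B2b hodge-weil CARVER gen 2 (planner-b2b-hweil-carver-g2-0), 2026-08-18; companion of the GAP census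
`pohlmann6.g` (kit job j038496) and `x2_check.py` in `run/shared/lean/b2b/hodge-weil/b2b-hweil-carver-g2/`.
-/

namespace Literature.AlgebraicGeometry.HodgeTheory.PohlmannZeta24

open Finset

/-- The point set: embeddings of `ℚ(ζ₂₄)` (units of `ℤ/24`) and of the two quadratic fields. [folklore] -/
abbrev Pt : Type := ZMod 24 ⊕ (Bool ⊕ Bool)

/-- The imaginary quadratic subfields of `ℚ(ζ₂₄)`. [folklore] -/
inductive IQ | i | m2 | m3 | m6
  deriving DecidableEq, Fintype, Repr

/-- `fixes k g`: the unit `g ∈ (ℤ/24)ˣ` restricts to the identity of `k`. [folklore] -/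
def fixes : IQ → ZMod 24 → Bool
  | .i,  g => g.val % 4 == 1
  | .m2, g => g.val % 8 == 1 || g.val % 8 == 3
  | .m3, g => g.val % 3 == 1
  | .m6, g => (g.val % 8 == 1 || g.val % 8 == 3) == (g.val % 12 == 1 || g.val % 12 == 11)

/-- The units of `ℤ/24` (`= Gal(ℚ(ζ₂₄)/ℚ) ≅ C₂³`). [folklore] -/
def units24 : Finset (ZMod 24) := univ.filter fun t => t.val.Coprime 24

/-- The twelve points `Hom(E, ℂ)` of the CM algebra `E = ℚ(ζ₂₄) × k′ × k″`. [cite: GaoUllmo2025, §2.1] -/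
def pts : Finset Pt :=
  units24.image Sum.inl ∪ {Sum.inr (Sum.inl true), Sum.inr (Sum.inl false),
    Sum.inr (Sum.inr true), Sum.inr (Sum.inr false)}

/-- The Galois action of a unit `g` on the points, for the pair of quadratic fields `(k′, k″)`.
[cite: GaoUllmo2025, §3.1] -/
def act (k₁ k₂ : IQ) (g : ZMod 24) : Pt → Pt
  | Sum.inl t => Sum.inl (g * t)
  | Sum.inr (Sum.inl b) => Sum.inr (Sum.inl (if fixes k₁ g then b else !b))
  | Sum.inr (Sum.inr b) => Sum.inr (Sum.inr (if fixes k₂ g then b else !b))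

/-- The CM type of `B`: `{σ₁, σ₅, σ₇, σ₁₃}`. [folklore] -/
def phiB : Finset (ZMod 24) := {1, 5, 7, 13}

/-- The CM type of `A = B × E′ × E″`: `Φ_B ⊔ {ι′} ⊔ {ι″}`. [cite: GaoUllmo2025, §2.2] -/
def phi : Finset Pt := phiB.image Sum.inl ∪ {Sum.inr (Sum.inl true), Sum.inr (Sum.inr true)}

/-- `Φ_B` is a CM type of `ℚ(ζ₂₄)`: units, exactly one of `t, -t`. [folklore] -/
theorem isCMType_phiB : (∀ t ∈ phiB, t.val.Coprime 24) ∧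
    ∀ t : ZMod 24, t.val.Coprime 24 → (t ∈ phiB ↔ -t ∉ phiB) := by decide

set_option maxHeartbeats 1000000 in
/-- `Φ_B` is PRIMITIVE: no unit `g ≠ 1` maps `Φ_B` onto itself (so `B` is simple, `End⁰(B) = ℚ(ζ₂₄)`,
by Shimura–Taniyama). [folklore] -/
theorem primitive_phiB : ∀ g ∈ units24, phiB.image (fun t => g * t) = phiB → g = 1 := by decide

set_option maxHeartbeats 1000000 in
/-- Restriction multiplicities of `Φ_B` to each imaginary quadratic subfield are `(3,1)` or `(1,3)`, never
`(2,2)` — Moonen–Zarhin case (g) for `E_k × B`, and `B` is not of Weil type for any `k`.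
[cite: MoonenZarhin1999, Introduction (g)] -/
theorem restriction_multiplicities :
    ∀ k : IQ, (phiB.filter fun t => fixes k t).card = 3 ∨ (phiB.filter fun t => fixes k t).card = 1 := by
  decide

/-- Pohlmann's condition (3.2) for a set of points: `|gP ∩ Φ| = 2` for every unit `g` (for `|P| = 4` this is
`|gP ∩ Φ| = |gP ∩ Φ̄|`), written as `#{x ∈ P | g·x ∈ Φ} = 2` (the action of `g` is injective).
[cite: GaoUllmo2025, Thm 3.1 eq. (3.2)] -/
def Eq32 (k₁ k₂ : IQ) (P : Finset Pt) : Prop :=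
  ∀ g ∈ units24, (P.filter fun x => act k₁ k₂ g x ∈ phi).card = 2

/-- `Eq32` is decidable (a finite conjunction). [folklore] -/
instance (k₁ k₂ : IQ) (P : Finset Pt) : Decidable (Eq32 k₁ k₂ P) := by unfold Eq32; infer_instance

/-- The Pohlmann `4`-sets: by [cite: GaoUllmo2025, Thm 3.1] they index a basis of `B²(A) ⊗ ℂ`. -/
def hodgeSets (k₁ k₂ : IQ) : Finset (Finset Pt) := (pts.powersetCard 4).filter (Eq32 k₁ k₂)

/-- The exceptional ones: not stable under complex conjugation `g = -1`, i.e. not a union of two conjugate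
pairs (unions of pairs span `D²(A) ⊗ ℂ`, products of divisor classes — DERIVED from [cite: GaoUllmo2025, Thm 3.1]
at `p = 1` and the degree-one census `divisorSets_i_m3` below). [cite: MoonenZarhin1999, Introduction] -/
def exceptional (k₁ k₂ : IQ) : Finset (Finset Pt) :=
  (hodgeSets k₁ k₂).filter fun P => ∃ x ∈ P, act k₁ k₂ (-1) x ∉ P

set_option maxRecDepth 8000 in
set_option maxHeartbeats 4000000 in
/-- **The census**, lead pair `(k′, k″) = (ℚ(i), ℚ(√-3))`: exactly `19` Pohlmann `4`-sets. Via
[cite: GaoUllmo2025, Thm 3.1]: `dim_ℚ B²(B × E′ × E″) = 19`, while `dim D²(A) ⊗ ℂ ≤ 15` (unions of two of the six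
conjugate pairs). [cite: GaoUllmo2025, Thm 3.1] [cite: MoonenZarhin1999, Introduction (g)] -/
theorem card_hodgeSets_i_m3 : (hodgeSets .i .m3).card = 19 := by decide +kernel

set_option maxRecDepth 8000 in
set_option maxHeartbeats 4000000 in
/-- The four exceptional sets for `(k′, k″) = (ℚ(i), ℚ(√-3))`, explicitly:
`{σ₁, σ₁₃, ῑ′, ῑ″}`, `{σ₅, σ₁₇, ῑ′, ι″}`, `{σ₇, σ₁₉, ι′, ῑ″}`, `{σ₁₁, σ₂₃, ι′, ι″}` — one Galois orbit, each of
Künneth multidegree `(2,1,1)` (two embeddings of `ℚ(ζ₂₄)`, one of each quadratic field); the first is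
`e_{σ₁} ∧ e_{σ₁₃} ⊗ ē′ ⊗ ē″ ∈ H^{2,0}(B) ⊗ H^{0,1}(E′) ⊗ H^{0,1}(E″)`. (The other five pairs `k′ ≠ k″` give the
same counts `19 = 15 + 4` with multidegree `(2,1,1)` — checked outside Lean by `x2_check.py`; not restated here to keep
the kernel computation small.) [cite: GaoUllmo2025, Thm 3.1] -/
theorem exceptional_i_m3 : exceptional .i .m3 =
    { {Sum.inl 1, Sum.inl 13, Sum.inr (Sum.inl false), Sum.inr (Sum.inr false)},
      {Sum.inl 5, Sum.inl 17, Sum.inr (Sum.inl false), Sum.inr (Sum.inr true)},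
      {Sum.inl 7, Sum.inl 19, Sum.inr (Sum.inl true), Sum.inr (Sum.inr false)},
      {Sum.inl 11, Sum.inl 23, Sum.inr (Sum.inl true), Sum.inr (Sum.inr true)} } := by
  decide +kernel

/-! ### Degree one: the (3.2) `2`-sets are the six conjugate pairs (so `D²(A) ⊗ ℂ` = span of unions of two pairs)

[cite: GaoUllmo2025, Thm 3.1] is stated "for each `p ≥ 0`"; at `p = 1` it says that `B¹(A) ⊗ ℂ` has basis the
`[P]`, `|P| = 2`, with `|gP ∩ Φ| = |gP ∩ Φ̄|` (`= 1`) for all `g ∈ G`, and `dim_ℚ B¹(A)` = their number.  The kernel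
census below shows that for the lead pair these `2`-sets are exactly the six pairs `{x, x̄}` (`x̄ = (-1)·x`); hence
(derived) `dim_ℚ B¹(A) = 6`, and the subring generated by divisor classes has `D²(A) ⊗ ℂ = B¹ · B¹` spanned by the
`[Pᵢ] ∧ [Pⱼ] = ± [Pᵢ ∪ Pⱼ]`, `i ≠ j` — the `15` unions of two distinct pairs, which are among the `19` sets of
`card_hodgeSets_i_m3` (a `(-1)`-stable `4`-set is a union of two pairs), leaving the `4` sets of `exceptional_i_m3`. -/

/-- Pohlmann's condition (3.2) in degree `p = 1` (`|P| = 2`): `#{x ∈ P | g·x ∈ Φ} = 1` for every unit `g`.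
[cite: GaoUllmo2025, Thm 3.1 eq. (3.2)] -/
def Eq32one (k₁ k₂ : IQ) (P : Finset Pt) : Prop :=
  ∀ g ∈ units24, (P.filter fun x => act k₁ k₂ g x ∈ phi).card = 1

/-- `Eq32one` is decidable (a finite conjunction). [folklore] -/
instance (k₁ k₂ : IQ) (P : Finset Pt) : Decidable (Eq32one k₁ k₂ P) := by unfold Eq32one; infer_instance

/-- The degree-one Pohlmann sets: by [cite: GaoUllmo2025, Thm 3.1] (`p = 1`) they index a basis of `B¹(A) ⊗ ℂ`. -/
def divisorSets (k₁ k₂ : IQ) : Finset (Finset Pt) := (pts.powersetCard 2).filter (Eq32one k₁ k₂)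

/-- The complex-conjugate pairs `{x, x̄}`, `x̄ = (-1)·x`, of the twelve points. [folklore] -/
def conjPairs (k₁ k₂ : IQ) : Finset (Finset Pt) := pts.image fun x => {x, act k₁ k₂ (-1) x}

set_option maxRecDepth 8000 in
set_option maxHeartbeats 4000000 in
/-- **Degree-one census**, lead pair `(k′, k″) = (ℚ(i), ℚ(√-3))`: the (3.2) `2`-sets are exactly the conjugate
pairs, and there are six of them.  Via [cite: GaoUllmo2025, Thm 3.1] (`p = 1`): `dim_ℚ B¹(B × E′ × E″) = 6` with basis
the pair monomials, whence `dim D²(A) ⊗ ℂ = 15` (derived, see the section docstring).  (The other five pairs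
`k′ ≠ k″` give the same census — checked outside Lean, as for `exceptional_i_m3`.) -/
theorem divisorSets_i_m3 : divisorSets .i .m3 = conjPairs .i .m3 ∧ (conjPairs .i .m3).card = 6 := by
  decide +kernel

end Literature.AlgebraicGeometry.HodgeTheory.PohlmannZeta24
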